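import Summits.BirchSwinnertonDyer.BirchSwinnertonDyer.Theorems.KimAtThreeDeepUpperCiteOnly
import Literature.NumberTheory.PAdicHodge.DualExpEllipticTowerSelf
import HarnessLib

/-!
# Crux `DeepUpperAtThree` (stmt-BirchSwinnertonDyer-19076) BY NAME from NINE cite-only named facts
# (route `KimAtThreeKolyvagin`, rung W2 of `BirchSwinnertonDyer`; cell `bsd-addord`, seat w2-c3 gen 11 = LEAD of 19076)

HONEST FRAMING.  Four one-line composition theorems (no definition, no instance, no `sorry`).  The gen-10 closer
`KimAtThreeDeepUpperCiteOnly.deepUpperAtThree_of_lit_of_facts` (p539377) displayed TEN cite-only named statements; one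
of them, the single-field Tate-duality range fact (S5b) `PAdicHodge.exists_smul_range_expStarCoord_iff_trace_log`, is now
a KERNEL CONSEQUENCE of the tower fact (S5b-tower) `PAdicHodge.exists_smul_range_expStarCoord_tower_iff_trace_log` by
kim3 g17's Literature theorem `PAdicHodge.exists_smul_range_expStarCoord_iff_trace_log_of_tower` (p542762, file
`Literature/NumberTheory/PAdicHodge/DualExpEllipticTowerSelf.lean`: the self-restriction `Γ_F → Γ_F` is an inner
automorphism, so the trivial tower `F = F₀` of the tower fact gives the single-field fact).  Substituting it, the crux
`Summit.BirchSwinnertonDyer.BirchSwinnertonDyer.Theses.KimAtThreeKolyvagin.DeepUpperAtThree` BY NAME follows from NINE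
cite-only named statements: the four held-PUB route leaves `SakamotoKolyvaginThree` [Sakamoto 2024 Thm. 4.4],
`RankEqAnalyticRankLeOne` [Gross–Zagier–Kolyvagin], `PoitouTateSelmerDuality` [Poitou–Tate / Mazur–Rubin],
`CarayolLevelEqConductor` [Carayol 1986]; FOUR `p`-adic Hodge facts of `PAdicHodge/DualExpElliptic{,Tower}` — (P123)
`cupLogInjective_and_hasDualExp_of_isDeRham` [Kato II Prop. 1.2.3], (DR) `isDeRham_restrictedRationalTateRep` [Kato II
Ex. 1.3.5], (S5a) `expStarCoord_eq_zero_iff_kummer` [BK90 3.8/3.11], (S5b-tower)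
`exists_smul_range_expStarCoord_tower_iff_trace_log` [Kato II Thm. 1.4.1 + BK90 3.8 at two levels]; and the Kato fact
`Kato2004.exists_eulerSystem_definedExpStar_values` [Kato 2004 (8.1.3)/Ex. 13.3, Prop. 8.12, §9.4, Thm. 9.7,
Thm. 6.6 (1)].  The theorems stay CONDITIONAL (gate class `conditional-result`): the hypotheses are unproved published
results (D-0014); the item is NOT closed by this file and BSD is NOT proved by any of this («closes rung 19076 of
BirchSwinnertonDyer» modulo the nine cited statements, never summit credit).

Also recorded, by the same substitution: the child crux `DeepUpperAtThreeOffKatoStratum` (19562), the pair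
`DeepLowerAtThree ∧ DeepUpperAtThree` and the route leaf `N11.KimAtThreeDeepPUB` from the same nine statements.  The
standalone nine-input closers of w2-c2's items 19075 / 19679 / 20013 are w2-c2's (their announced
`Theorems/KimAtThreeDeepLowerKatoCiteOnlyNine.lean`); they are not repeated here.

References: [Kim2025RefinedTNC] Thm. 1.1; [Sakamoto2024] Thm. 4.4; [MazurRubin2004] Thm. 5.2.12; [Carayol1986];
[Kato2004Asterisque] (8.1.3), Prop. 8.12, §9.4, Thm. 9.7, Thm. 6.6 (1), Ex. 13.3; [Kato1993LNM1553] II Prop. 1.2.3,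
§1.2.4, Ex. 1.3.5, Thm. 1.4.1; [BlochKato1990] §3 Prop. 3.8, Ex. 3.11.
-/

noncomputable section

-- the cell's Theorems namespace `Summit.BirchSwinnertonDyer.BirchSwinnertonDyer.…` repeats the summit name by design (D-0017)
set_option linter.dupNamespace false

open Literature.NumberTheory.EllipticCurves Literature.NumberTheory.EllipticCurves.Rank1Residual
open Literature.NumberTheory.GaloisRepresentations Literature.NumberTheory.PAdicHodge
open Literature.NumberTheory.EllipticCurves.Kato2004
open Summit.BirchSwinnertonDyer.Rank1Residual.Additive
open Summit.BirchSwinnertonDyer.BirchSwinnertonDyer.Theses.KimAtThreeKolyvagin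
open Summit.BirchSwinnertonDyer.BirchSwinnertonDyer.Theorems.KimAtThreeDeepUpperCiteOnly

namespace Summit.BirchSwinnertonDyer.BirchSwinnertonDyer.Theorems.KimAtThreeDeepUpperCiteNine

/-- ★★ **Crux `DeepUpperAtThree` (19076) BY NAME from NINE cite-only named facts**: the Kato-side UPPER half
`ord₃ #Ш(E/ℚ)[3^∞] + ∂^{(∞)}_deep(δ̃) ≤ ∂^{(0)}(δ̃)` for every `3`-adic-tower-surjective `E/ℚ` with finite `Ш`,
`3`-integral plus symbols and `∂^{(0)}`-vanishing order `0` — the gen-10 ten-input closer with its (S5b) hypothesis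
DISCHARGED by kim3's `exists_smul_range_expStarCoord_iff_trace_log_of_tower hT₂`.  CONDITIONAL on the nine displayed
named facts. [cite: Kim2025RefinedTNC, Thm 1.1]
[cite: Kato2004Asterisque, (8.1.3) (p. 180), Prop. 8.12 (p. 186), §9.4 and Thm. 9.7 (pp. 188–189), Thm. 6.6 (1) (p. 163), Ex. 13.3 (pp. 224–225)]
[cite: Sakamoto2024, Thm. 4.4 (p. 926)] [cite: MazurRubin2004, Thm. 5.2.12] [cite: Carayol1986]
[cite: Kato1993LNM1553, Ch. II Prop. 1.2.3, §1.2.4 and Thm. 1.4.1] [cite: BlochKato1990, §3 Prop. 3.8 and Ex. 3.11] -/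
theorem deepUpperAtThree_of_nine_facts
    (hLit : Kato2004.exists_eulerSystem_definedExpStar_values)
    (hSak : SakamotoKolyvaginThree) (hGZK : RankEqAnalyticRankLeOne) (hPT : PoitouTateSelmerDuality)
    (hlev : CarayolLevelEqConductor)
    (hP : cupLogInjective_and_hasDualExp_of_isDeRham) (hDR : isDeRham_restrictedRationalTateRep)
    (hS : expStarCoord_eq_zero_iff_kummer) (hT₂ : exists_smul_range_expStarCoord_tower_iff_trace_log) :
    Summit.BirchSwinnertonDyer.BirchSwinnertonDyer.Theses.KimAtThreeKolyvagin.DeepUpperAtThree :=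
  deepUpperAtThree_of_lit_of_facts hLit hSak hGZK hPT hlev hP hDR hS
    (exists_smul_range_expStarCoord_iff_trace_log_of_tower hT₂) hT₂

/-- ★ **`DeepLowerAtThree ∧ DeepUpperAtThree` (19075 ∧ 19076) BY NAME from the same nine cite-only facts** (for the
record; the lower half is w2-c2's item). Conditional. [cite: Kim2025RefinedTNC, Thm 1.1] [cite: Sakamoto2024, Thm. 4.4 (p. 926)]
[cite: Kato2004Asterisque, §9.4 and Thm. 9.7 (pp. 188–189)] -/
theorem deepLower_and_deepUpper_of_nine_facts
    (hLit : Kato2004.exists_eulerSystem_definedExpStar_values)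
    (hSak : SakamotoKolyvaginThree) (hGZK : RankEqAnalyticRankLeOne) (hPT : PoitouTateSelmerDuality)
    (hlev : CarayolLevelEqConductor)
    (hP : cupLogInjective_and_hasDualExp_of_isDeRham) (hDR : isDeRham_restrictedRationalTateRep)
    (hS : expStarCoord_eq_zero_iff_kummer) (hT₂ : exists_smul_range_expStarCoord_tower_iff_trace_log) :
    Summit.BirchSwinnertonDyer.BirchSwinnertonDyer.Theses.KimAtThreeKolyvagin.DeepLowerAtThree ∧
      Summit.BirchSwinnertonDyer.BirchSwinnertonDyer.Theses.KimAtThreeKolyvagin.DeepUpperAtThree :=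
  deepLower_and_deepUpper_of_lit_of_facts hLit hSak hGZK hPT hlev hP hDR hS
    (exists_smul_range_expStarCoord_iff_trace_log_of_tower hT₂) hT₂

/-- **Child crux `DeepUpperAtThreeOffKatoStratum` (19562, a child of 19076's split of record) BY NAME from the nine
cite-only facts.** Conditional. [cite: Kim2025RefinedTNC, Thm 1.1] [cite: Sakamoto2024, Thm. 4.4 (p. 926)] -/
theorem deepUpperAtThreeOffKatoStratum_of_nine_facts
    (hLit : Kato2004.exists_eulerSystem_definedExpStar_values)
    (hSak : SakamotoKolyvaginThree) (hGZK : RankEqAnalyticRankLeOne) (hPT : PoitouTateSelmerDuality)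
    (hP : cupLogInjective_and_hasDualExp_of_isDeRham) (hDR : isDeRham_restrictedRationalTateRep)
    (hS : expStarCoord_eq_zero_iff_kummer) (hT₂ : exists_smul_range_expStarCoord_tower_iff_trace_log) :
    Summit.BirchSwinnertonDyer.BirchSwinnertonDyer.Theses.KimAtThreeKolyvagin.DeepUpperAtThreeOffKatoStratum :=
  deepUpperAtThreeOffKatoStratum_of_lit_of_facts hLit hSak hGZK hPT hP hDR hS
    (exists_smul_range_expStarCoord_iff_trace_log_of_tower hT₂) hT₂

/-- ★★ **The route leaf `N11.KimAtThreeDeepPUB` BY NAME from the nine cite-only facts** (the deep form of B3 = N11@3).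
Conditional; nothing booked. [cite: Kim2025RefinedTNC, Thm 1.1] [cite: Kim2022StructureSelmer, Thm. 1.9 (6), Thm. 3.13]
[cite: Sakamoto2024, Thm. 4.4 (p. 926)] [cite: Kato2004Asterisque, §9.4 and Thm. 9.7 (pp. 188–189)] -/
theorem kimAtThreeDeepPUB_of_nine_facts
    (hLit : Kato2004.exists_eulerSystem_definedExpStar_values)
    (hSak : SakamotoKolyvaginThree) (hGZK : RankEqAnalyticRankLeOne) (hPT : PoitouTateSelmerDuality)
    (hlev : CarayolLevelEqConductor)
    (hP : cupLogInjective_and_hasDualExp_of_isDeRham) (hDR : isDeRham_restrictedRationalTateRep)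
    (hS : expStarCoord_eq_zero_iff_kummer) (hT₂ : exists_smul_range_expStarCoord_tower_iff_trace_log) :
    N11.KimAtThreeDeepPUB :=
  kimAtThreeDeepPUB_of_lit_of_facts hLit hSak hGZK hPT hlev hP hDR hS
    (exists_smul_range_expStarCoord_iff_trace_log_of_tower hT₂) hT₂

end Summit.BirchSwinnertonDyer.BirchSwinnertonDyer.Theorems.KimAtThreeDeepUpperCiteNine

end
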